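import Summits.CriticalPhenomena.PercolationContinuityZ3.Theorems.PercNearOneGluingNoHeavyLowerTailSahiGridThreeCheck

/-!
# `NoHeavyLowerTail` (crux stmt-CriticalPhenomena-4575), Sahi programme P1: the FINITE CERTIFICATE — tri-coefficient positivity of
# the three-copy pattern kernel on `[3]³`, part 2: chunks 3 and 4 of 6

Support file (Sahi cell, seat `prim-sahi-p1`, generation 6; `--supports stmt-CriticalPhenomena-4575`).  COMPUTATIONAL (`native_decide`)
like part 1 (`…SahiGridThreeCheck`, whose `checkChunk` and soundness lemma `nonneg_of_checkChunk` it uses); no `sorry`.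
Chunks 3 and 4 of the sorted-triple check: first indices `[141, 230)` and `[230, 340)`. [this work]
-/

namespace Summit.CriticalPhenomena.PercolationContinuityZ3.Theorems.SahiGrid3

/-- THE CERTIFICATE, chunk 3: first indices `[141, 230)` (COMPUTATIONAL, `native_decide`). [this work] -/
theorem checkChunk_3 : checkChunk 141 89 = true := by native_decide

/-- THE CERTIFICATE, chunk 4: first indices `[230, 340)` (COMPUTATIONAL, `native_decide`). [this work] -/
theorem checkChunk_4 : checkChunk 230 110 = true := by native_decide

end Summit.CriticalPhenomena.PercolationContinuityZ3.Theorems.SahiGrid3
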